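import Summits.ValiantsHypothesis.ValiantsHypothesis.Theorems.BarrierLeverTransversalMinorLayoutsFiniteCheck

/-!
# Route BarrierLever — conjecture TT (`TransversalMinorLayoutsNonsingular`, stmt-ValiantsHypothesis-19152):
# TT for layouts with at most FIVE rows, every height

Helper file (`--supports stmt-ValiantsHypothesis-19152`; cell valiant-natproofs, rung V4, 𝒟-side of
door (c); seat val-np-p1 gen 8).  Companion of `…TransversalMinorLayoutsFiniteCheck`: its bounded
locked-complex engine `FiniteCheck.tt_rank_le_of_lockedCore` reduces TT for `r ≤ R` rows to the
LOCKED pairs of injective lower-set layouts (simplicial complexes) with `r ≤ R` faces at heights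
`h < r`.  For `R = 5` the only cell beyond the tree's `h ≤ 3` theorem
(`PPSmall.transversalMinorLayouts_nonsingular_of_le_three`) is `(h, r) = (4, 5)`, and it is EMPTY:

* `card_le_two_of_mem_lowerFamily`: a lower family of fewer than `8` sets consists of sets of size
  `≤ 2` (complexes with `< 8` faces are graphs);
* `exists_mem_unique_of_card_five` / `exists_degree_one_of_five`: a complex with exactly five faces
  has a vertex lying in exactly one face — so two such complexes always have literal classes of the
  common size `1` and are never locked;
* `transversalMinorLayouts_nonsingular_of_r_le_five`: **TT (item 19152's conclusion verbatim) for
  every injective layout pair with `r ≤ 5` rows, at every height `h`.**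

For `r = 6` the first genuinely locked pair appears (the `5`-claw against a `3`-vertex path with
two unused coordinates, at `h = 5`); that cell needs a certificate and is not treated here.

WHAT THIS IS NOT: a bounded-rank slice of TT; nothing on TT / item 19761 in general, on crux
stmt-ValiantsHypothesis-14610, or on `VP` versus `VNP`.
-/

-- layout Summits/ValiantsHypothesis/ValiantsHypothesis forces the duplicated namespace component
set_option linter.dupNamespace false

open Matrix Finset

namespace Summit.ValiantsHypothesis.ValiantsHypothesis.Theorems.BarrierLever.FiniteCheck

open Summit.ValiantsHypothesis.ValiantsHypothesis.Theorems.BarrierLever.Compression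

/-! ## 1. Small lower families -/

/-- A lower family of fewer than `8` sets has members of size at most `2`: the `8` subsets of a
`3`-element subset of a member would all be members. -/
theorem card_le_two_of_mem_lowerFamily {h : ℕ} (F : Finset (Finset (Fin h)))
    (hlow : ∀ x ∈ F, ∀ t, t ⊆ x → t ∈ F) (hF : F.card < 8) (x : Finset (Fin h)) (hx : x ∈ F) :
    x.card ≤ 2 := by
  classical
  by_contra hlt
  push Not at hlt
  obtain ⟨S, hS, hScard⟩ := Finset.exists_subset_card_eq (show 3 ≤ x.card by omega)
  have hsub : S.powerset ⊆ F := by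
    intro t ht
    rw [Finset.mem_powerset] at ht
    exact hlow x hx t (ht.trans hS)
  have h1 := Finset.card_le_card hsub
  rw [Finset.card_powerset, hScard] at h1
  omega

/-- A lower family of exactly five sets has an element lying in exactly one member.  (Members
have size `≤ 2`.  If some member is a pair `{a, b}`, the family is `{∅, {a}, {b}, {a, b}, F}`
with a fifth member `F`; `F` cannot be a pair — its singletons would be `{a}`, `{b}` — so
`F = {c}` with `c ∉ {a, b}`, and `c` lies in `F` only.  Otherwise all members have size `≤ 1`
and the element of any nonempty member lies in that member only.) -/
theorem exists_mem_unique_of_card_five {h : ℕ} (F : Finset (Finset (Fin h)))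
    (hlow : ∀ x ∈ F, ∀ t, t ⊆ x → t ∈ F) (hF : F.card = 5) :
    ∃ c : Fin h, (F.filter fun x => c ∈ x).card = 1 := by
  classical
  have hle2 := card_le_two_of_mem_lowerFamily F hlow (by omega)
  by_cases hB : ∃ x ∈ F, x.card = 2
  · obtain ⟨x, hx, hx2⟩ := hB
    obtain ⟨a, b, hab, rfl⟩ := Finset.card_eq_two.mp hx2
    -- the four subsets of `{a, b}`
    set P : Finset (Finset (Fin h)) := {∅, {a}, {b}, {a, b}} with hPdef
    have hPF : P ⊆ F := by
      intro t ht
      simp only [hPdef, Finset.mem_insert, Finset.mem_singleton] at ht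
      rcases ht with rfl | rfl | rfl | rfl
      · exact hlow _ hx _ (Finset.empty_subset _)
      · exact hlow _ hx _ (by simp)
      · exact hlow _ hx _ (by simp)
      · exact hx
    have hPcard : P.card = 4 := by
      have h1 : (∅ : Finset (Fin h)) ∉ ({{a}, {b}, {a, b}} : Finset (Finset (Fin h))) := by
        simp only [Finset.mem_insert, Finset.mem_singleton, not_or]
        exact ⟨(Finset.singleton_ne_empty a).symm, (Finset.singleton_ne_empty b).symm,
          fun e => by simpa using (e.symm ▸ Finset.mem_insert_self a {b} : a ∈ (∅ : Finset _))⟩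
      have h2 : ({a} : Finset (Fin h)) ∉ ({{b}, {a, b}} : Finset (Finset (Fin h))) := by
        simp only [Finset.mem_insert, Finset.mem_singleton, not_or]
        refine ⟨fun e => hab (Finset.singleton_injective e), fun e => hab ?_⟩
        have : b ∈ ({a} : Finset (Fin h)) := by rw [e]; simp
        exact (Finset.mem_singleton.mp this).symm
      have h3 : ({b} : Finset (Fin h)) ≠ {a, b} := by
        intro e
        have : a ∈ ({b} : Finset (Fin h)) := by rw [e]; simp
        exact hab (Finset.mem_singleton.mp this)
      rw [hPdef, Finset.card_insert_of_notMem h1, Finset.card_insert_of_notMem h2,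
        Finset.card_pair h3]
    -- the fifth member
    obtain ⟨f, hf⟩ : ∃ f, f ∈ F \ P := by
      apply Finset.Nonempty.exists_mem
      rw [← Finset.card_pos, Finset.card_sdiff_of_subset hPF, hF, hPcard]
      omega
    rw [Finset.mem_sdiff] at hf
    obtain ⟨hfF, hfP⟩ := hf
    have hFeq : F = insert f P := by
      symm
      apply Finset.eq_of_subset_of_card_le
      · exact Finset.insert_subset hfF hPF
      · rw [Finset.card_insert_of_notMem hfP, hPcard, hF]
    have hfle := hle2 f hfF
    have hfP' : f ≠ ∅ ∧ f ≠ {a} ∧ f ≠ {b} ∧ f ≠ {a, b} := by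
      simpa only [hPdef, Finset.mem_insert, Finset.mem_singleton, not_or] using hfP
    rcases Nat.lt_or_ge f.card 2 with hf1 | hf2
    · -- `f = {c}`
      have hfc : f.card = 1 := by
        rcases Nat.lt_or_ge f.card 1 with h0 | h1
        · exact absurd (Finset.card_eq_zero.mp (by omega)) hfP'.1
        · omega
      obtain ⟨c, rfl⟩ := Finset.card_eq_one.mp hfc
      have hca : c ≠ a := fun e => hfP'.2.1 (by rw [e])
      have hcb : c ≠ b := fun e => hfP'.2.2.1 (by rw [e])
      refine ⟨c, ?_⟩
      rw [hFeq, Finset.filter_insert, if_pos (Finset.mem_singleton_self c)]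
      have hPc : P.filter (fun x => c ∈ x) = ∅ := by
        apply Finset.filter_false_of_mem
        intro t ht
        simp only [hPdef, Finset.mem_insert, Finset.mem_singleton] at ht
        rcases ht with rfl | rfl | rfl | rfl <;> simp [hca, hcb]
      rw [hPc]
      simp
    · -- `f = {c, d}` is impossible
      exfalso
      have hf2' : f.card = 2 := le_antisymm hfle hf2
      obtain ⟨c, d, hcd, rfl⟩ := Finset.card_eq_two.mp hf2'
      have hsub : ∀ e : Fin h, e ∈ ({c, d} : Finset (Fin h)) → e = a ∨ e = b := by
        intro e he
        have h1 : ({e} : Finset (Fin h)) ∈ F :=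
          hlow _ hfF _ (Finset.singleton_subset_iff.mpr he)
        rw [hFeq, Finset.mem_insert] at h1
        rcases h1 with h1 | h1
        · exfalso
          have := congrArg Finset.card h1
          rw [Finset.card_singleton, Finset.card_pair hcd] at this
          omega
        · simp only [hPdef, Finset.mem_insert, Finset.mem_singleton] at h1
          rcases h1 with h1 | h1 | h1 | h1
          · exact absurd h1 (Finset.singleton_ne_empty e)
          · exact Or.inl (Finset.singleton_injective h1)
          · exact Or.inr (Finset.singleton_injective h1)
          · exfalso
            have := congrArg Finset.card h1
            rw [Finset.card_singleton, Finset.card_pair hab] at this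
            omega
      apply hfP'.2.2.2
      apply Finset.eq_of_subset_of_card_le
      · intro e he
        rcases hsub e he with rfl | rfl <;> simp
      · rw [Finset.card_pair hab, Finset.card_pair hcd]
  · -- all members have size ≤ 1
    push Not at hB
    have hle1 : ∀ x ∈ F, x.card ≤ 1 := fun x hx => by
      have := hle2 x hx
      have := hB x hx
      omega
    obtain ⟨x, hxF, hxne⟩ : ∃ x ∈ F, x ≠ ∅ := by
      by_contra hno
      push Not at hno
      have : F ⊆ {∅} := fun x hx => Finset.mem_singleton.mpr (hno x hx)
      have := Finset.card_le_card this
      rw [Finset.card_singleton, hF] at this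
      omega
    have hx1 : x.card = 1 := by
      have := hle1 x hxF
      rcases Nat.lt_or_ge x.card 1 with h0 | h1
      · exact absurd (Finset.card_eq_zero.mp (by omega)) hxne
      · omega
    obtain ⟨c, rfl⟩ := Finset.card_eq_one.mp hx1
    refine ⟨c, ?_⟩
    have : F.filter (fun x => c ∈ x) = {{c}} := by
      apply Finset.eq_singleton_iff_unique_mem.mpr
      refine ⟨Finset.mem_filter.mpr ⟨hxF, Finset.mem_singleton_self c⟩, fun y hy => ?_⟩
      rw [Finset.mem_filter] at hy
      obtain ⟨hyF, hcy⟩ := hy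
      exact (Finset.eq_singleton_iff_unique_mem.mpr ⟨hcy, fun e he =>
        Finset.card_le_one.mp (hle1 y hyF) e he c hcy⟩)
    rw [this, Finset.card_singleton]

/-- Every injective lower-set layout with exactly five members has a coordinate lying in exactly
one member (so both its literal classes at that coordinate have sizes `1` and `4`). -/
theorem exists_degree_one_of_five {h : ℕ} (u : Fin 5 → Finset (Fin h))
    (hu : Function.Injective u) (hl : IsLowerSet (Set.range u)) :
    ∃ a : Fin h, (Finset.univ.filter fun i => a ∈ u i).card = 1 := by
  classical
  have hlow : ∀ x ∈ Finset.univ.image u, ∀ t, t ⊆ x → t ∈ Finset.univ.image u := by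
    intro x hx t ht
    obtain ⟨i, _, rfl⟩ := Finset.mem_image.mp hx
    obtain ⟨j, hj⟩ := hl ht ⟨i, rfl⟩
    exact Finset.mem_image.mpr ⟨j, Finset.mem_univ _, hj⟩
  have hcard : (Finset.univ.image u).card = 5 := by
    rw [Finset.card_image_of_injective _ hu, Finset.card_univ, Fintype.card_fin]
  obtain ⟨c, hc⟩ := exists_mem_unique_of_card_five _ hlow hcard
  refine ⟨c, ?_⟩
  rw [← hc, Finset.filter_image, Finset.card_image_of_injective _ hu]

/-! ## 2. Five rows -/

/-- **TT for `r ≤ 5` rows, every `h`** (conclusion of item 19152 verbatim for these layouts).  By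
the bounded engine it suffices to treat locked lower-set pairs with `r ≤ 5` members at heights
`h < r`; for `h ≤ 3` TT is a tree theorem, and at `(h, r) = (4, 5)` there is NO locked pair: each
side has a coordinate of degree one (`exists_degree_one_of_five`), i.e. literal classes of the
common size `1`. -/
theorem transversalMinorLayouts_nonsingular_of_r_le_five (h r : ℕ) (hr : r ≤ 5)
    (u w : Fin r → Finset (Fin h)) (hu : Function.Injective u) (hw : Function.Injective w) :
    ∃ H : Matrix (Fin (h + h)) (Fin (h + h)) ℂ, (Matrix.of fun i j : Fin r => (H.submatrix
      (fun a : Fin h => if a ∈ u i then Fin.castAdd h a else Fin.natAdd h a)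
      (fun c : Fin h => if c ∈ w j then Fin.natAdd h c else Fin.castAdd h c)).det).det ≠ 0 := by
  classical
  refine tt_rank_le_of_lockedCore 5 (fun h r hr hhr u w hu hw hlu hlw hlk => ?_) h r hr u w hu hw
  by_cases hh : h ≤ 3
  · exact PPSmall.transversalMinorLayouts_nonsingular_of_le_three h r hh u w hu hw
  · exfalso
    have hr5 : r = 5 := by omega
    subst hr5
    obtain ⟨a, ha⟩ := exists_degree_one_of_five u hu hlu
    obtain ⟨c, hc⟩ := exists_degree_one_of_five w hw hlw
    apply hlk a c true true
    simp only [iff_true]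
    rw [ha, hc]

end Summit.ValiantsHypothesis.ValiantsHypothesis.Theorems.BarrierLever.FiniteCheck
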